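import Mathlib
import HarnessLib.Audit
import Summits.PneNP.PneNP.Theorems.ClusOshSucc

/-!
# Route ClusUniversalCertificate — the reduction `(LAST-STEP) ⟹ (OSH-RUNG)` (osh-P2.md §3, paper-proved; `oshRung_of_lastStep`)
(rung F-N1, cell pnp-ideate, crux `UniversalCertAll` = stmt-PneNP-19683; planner p1 g14, `lines/osh-P2.md` §3 "Reduction (proved)": with
`P(Y) := (m−1)|Y| + 2^m[Y=V] − S(Y) − Σ_Y def_Y`, F1(b) gives `P(Y) − P(U) − P(I) = |U| − 2^{m−1}[U = V' ≠ I] − Σ_Y def + Σ_U def + Σ_I def ≥ 0` by (LAST-STEP);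
restricted-model combinatorics — nothing here bears on `P` versus `NP`)

* `card_proj_add_card_dbl` (`|U| + |I| = |Y|`), `dbl_subset_proj`, `eq_univ_iff_dbl` (`Y = V ⟺ I = V'`), `dimAt_le`;
* `oshRung_zero`; `oshRung_succ : 1 ≤ N → LastStep N → OshRung N → OshRung (N+1)` (subtraction-free bookkeeping of the telescoping step; at `N = 0` the
  ℕ-truncated `(N−1)|Y|` of `OshRung 0` is too weak to feed the step, so the honest base is `OshRung 1`);
* `oshRung_of_lastStep_of_one : OshRung 1 → (∀ 1 ≤ N' < N, LastStep N') → OshRung N` — p1's reduction from the base `N = 1` and the base: `oshS_le` (`S ≤ N(|Y|−1)`),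
  `dimAt_eq_zero_of_card_le_one`, `one_le_lexIncr_univ_zero`, `oshRung_one`;
* `oshRung_of_lastStep : (∀ N' < N, LastStep N') → OshRung N` — p1's statement verbatim.
-/

set_option linter.dupNamespace false -- `Summit.PneNP.PneNP.…`: summit = sub-problem name (D-0017 single-conjunct layout)

namespace Summit.PneNP.PneNP.Theorems.ClusHilbert.Osh

open Finset
open Summit.PneNP.PneNP.Theorems.ClusCube (V)
open Summit.PneNP.PneNP.Theorems.ClusHilbert (dimAt)

variable {N : ℕ}

/-! ## Bookkeeping of the split -/

/-- A level has as many points as the corresponding part of `Y`. -/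
theorem card_lvl (Y : Finset (V (N + 1))) (b : ZMod 2) : (lvl Y b).card = (Y.filter fun y => y (Fin.last N) = b).card := by
  unfold lvl
  refine card_image_of_injOn fun y hy y' hy' h => ?_
  rw [mem_coe, mem_filter] at hy hy'
  rw [← Fin.snoc_init_self y, ← Fin.snoc_init_self y', hy.2, hy'.2, h]

/-- **`|U| + |I| = |Y|`.** -/
theorem card_proj_add_card_dbl (Y : Finset (V (N + 1))) : (proj Y).card + (dbl Y).card = Y.card := by
  classical
  unfold proj dbl
  rw [card_union_add_card_inter, card_lvl, card_lvl]
  have h := (card_filter_add_card_filter_not (s := Y) (fun y : V (N + 1) => y (Fin.last N) = 0))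
  have hnot : (Y.filter fun y => ¬ y (Fin.last N) = 0) = Y.filter fun y => y (Fin.last N) = 1 :=
    filter_congr fun y _ => by
      constructor
      · intro hy; rcases (by decide : ∀ z : ZMod 2, z = 0 ∨ z = 1) (y (Fin.last N)) with h0 | h1
        · exact absurd h0 hy
        · exact h1
      · intro hy; rw [hy]; decide
  simp only [hnot] at h
  exact h

/-- `I ⊆ U`. -/
theorem dbl_subset_proj (Y : Finset (V (N + 1))) : dbl Y ⊆ proj Y := fun _ hw => mem_union_left _ (mem_inter.1 hw).1

/-- **`Y = V ⟺ I = V'`.** -/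
theorem eq_univ_iff_dbl (Y : Finset (V (N + 1))) : Y = univ ↔ dbl Y = univ := by
  constructor
  · intro h
    refine eq_univ_iff_forall.2 fun w => mem_dbl.2 ⟨?_, ?_⟩ <;> rw [h] <;> exact mem_univ _
  · intro h
    refine eq_univ_iff_forall.2 fun y => ?_
    have hw := mem_dbl.1 (h ▸ mem_univ (Fin.init y))
    rcases (by decide : ∀ z : ZMod 2, z = 0 ∨ z = 1) (y (Fin.last N)) with h0 | h1
    · rw [← Fin.snoc_init_self y, h0]; exact hw.1
    · rw [← Fin.snoc_init_self y, h1]; exact hw.2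

/-- `dim_Y(y) ≤ N`. -/
theorem dimAt_le (Y : Finset (V N)) (y : V N) : dimAt Y y ≤ N := by
  unfold ClusHilbert.dimAt
  set S := {k : ℕ | ∃ A : AffineSubspace (ZMod 2) (V N), y ∈ A ∧ (∀ z ∈ A, z ∈ Y) ∧ Module.finrank (ZMod 2) A.direction = k} with hS
  rcases S.eq_empty_or_nonempty with h | h
  · rw [h, csSup_empty]; exact bot_le
  · refine csSup_le h fun k ⟨A, _, _, hk⟩ => ?_
    rw [← hk]
    exact (Submodule.finrank_le _).trans (by rw [Module.finrank_pi, Fintype.card_fin])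

/-- In dimension `0` every `S` is zero. -/
theorem oshS_zero (Y : Finset (V 0)) : oshS Y = 0 := by
  classical
  unfold oshS
  refine sum_eq_zero fun T _ => ?_
  have : T = ∅ := eq_empty_of_forall_notMem fun i _ => i.elim0
  subst this
  simp

/-! ## The reduction -/

/-- `(OSH-RUNG)` in dimension `0` (vacuous bookkeeping). -/
theorem oshRung_zero : OshRung 0 := by
  intro Y
  rw [oshS_zero, sum_eq_zero fun y _ => Nat.eq_zero_of_le_zero (dimAt_le Y y)]
  exact Nat.zero_le _

/-- **Step (`N ≥ 1`): `(LAST-STEP)` at `N` and `(OSH-RUNG)` at `N` give `(OSH-RUNG)` at `N + 1`** — the telescoping `P(Y) ≥ P(U) + P(I)` of osh-P2.md §3,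
subtraction-free.  (For `N = 0` the ℕ-truncated `(N − 1)|Y|` of `OshRung 0` is too weak to feed the step; `OshRung 1` is the honest base.) -/
theorem oshRung_succ (hN : 1 ≤ N) (hL : LastStep N) (hR : OshRung N) : OshRung (N + 1) := by
  intro Y
  have hU := hR (proj Y)
  have hI := hR (dbl Y)
  have hY := hL Y
  have hsucc := oshS_succ Y
  have hcard := card_proj_add_card_dbl Y
  -- the indicator bookkeeping: `2^N([U=V'] + [I=V']) ≤ 2^N [U = V' ≠ I] + 2^{N+1} [Y = V]`
  have hind : (if proj Y = univ then 2 ^ N else 0) + (if dbl Y = univ then 2 ^ N else 0) ≤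
      (if proj Y = univ ∧ dbl Y ≠ univ then 2 ^ N else 0) + (if Y = univ then 2 ^ (N + 1) else 0) := by
    by_cases hIu : dbl Y = univ
    · have hUu : proj Y = univ := eq_univ_of_forall fun w => dbl_subset_proj Y (hIu ▸ mem_univ w)
      have hYu : Y = univ := (eq_univ_iff_dbl Y).2 hIu
      rw [if_pos hUu, if_pos hIu, if_pos hYu, if_neg (fun h => h.2 hIu), pow_succ]
      omega
    · have hYu : Y ≠ univ := fun h => hIu ((eq_univ_iff_dbl Y).1 h)
      rw [if_neg hIu, if_neg hYu]
      by_cases hUu : proj Y = univ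
      · rw [if_pos hUu, if_pos ⟨hUu, hIu⟩]
      · rw [if_neg hUu, if_neg (fun h => hUu h.1)]
  -- `(N - 1)·c + c = N·c` for `N ≥ 1`, and `N·|Y| = N·|U| + N·|I|`
  have hmul : ∀ c : ℕ, (N - 1) * c + c = N * c := fun c => by
    rw [Nat.sub_one_mul, Nat.sub_add_cancel (Nat.le_mul_of_pos_left c hN)]
  have hmulU := hmul (proj Y).card
  have hmulI := hmul (dbl Y).card
  have hmulY : N * Y.card = N * (proj Y).card + N * (dbl Y).card := by rw [← hcard, Nat.mul_add]
  have hN1 : N + 1 - 1 = N := by omega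
  rw [hN1, hsucc]
  -- everything is now linear in the atoms
  generalize (N - 1) * (proj Y).card = aU at hU hmulU
  generalize (N - 1) * (dbl Y).card = aI at hI hmulI
  generalize N * Y.card = nY at hmulY ⊢
  generalize N * (proj Y).card = nU at hmulU hmulY
  generalize N * (dbl Y).card = nI at hmulI hmulY
  omega

/-- **Reduction from the honest base**: `OshRung 1` and `(LAST-STEP)` at all `1 ≤ N' < N` give `OshRung N` (`N ≥ 1`). -/
theorem oshRung_of_lastStep_of_one (h1 : OshRung 1) (N : ℕ) (hN : 1 ≤ N) (h : ∀ N', 1 ≤ N' → N' < N → LastStep N') : OshRung N := by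
  induction N with
  | zero => exact absurd hN (by omega)
  | succ N ih =>
    rcases Nat.eq_zero_or_pos N with h0 | hpos
    · subst h0; exact h1
    · exact oshRung_succ hpos (h N hpos (Nat.lt_succ_self N)) (ih hpos fun N' h1' hN' => h N' h1' (Nat.lt_succ_of_lt hN'))

/-! ## The honest base `N = 1` -/

/-- `S(Y) ≤ N·(|Y| − 1)`: there are `|Y|` standard monomials, `∅` among them when `Y ≠ ∅`, the others of degree `≤ N`. -/
theorem oshS_le (Y : Finset (V N)) : oshS Y ≤ N * (Y.card - 1) := by
  classical
  rcases Y.eq_empty_or_nonempty with rfl | hne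
  · -- no standard monomials at all
    have h0 : oshCount (∅ : Finset (V N)) N = 0 := by rw [oshCount_top, card_empty]
    unfold oshS
    rw [sum_eq_zero]
    · exact Nat.zero_le _
    · intro T _
      rw [if_neg]
      intro hT
      unfold oshCount at h0
      rw [card_eq_zero, filter_eq_empty_iff] at h0
      exact h0 (mem_univ T) ⟨hT, (card_le_univ T).trans (by rw [Fintype.card_fin])⟩
  · -- `∅` is standard and weighs nothing; the other `|Y| − 1` weigh at most `N` each
    have hstd0 : colexStd Y ∅ := by
      unfold colexStd
      have hempty : {T' : Finset (Fin N) | toColex T' < toColex (∅ : Finset (Fin N))} = ∅ := by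
        ext T'
        simp only [Set.mem_setOf_eq, Set.mem_empty_iff_false, iff_false, not_lt]
        rw [Colex.toColex_le_toColex]
        intro a ha _; exact absurd ha (notMem_empty a)
      rw [hempty, Set.image_empty, Submodule.span_empty, Submodule.mem_bot]
      intro h
      obtain ⟨y, hy⟩ := hne
      have := congrFun h ⟨y, hy⟩
      simp [ClusHilbert.resTo, ClusHilbert.chi] at this
    unfold oshS
    have hsplit := (sum_erase_add univ (fun T : Finset (Fin N) => if colexStd Y T then T.card else 0) (mem_univ ∅)).symm
    rw [hsplit, if_pos hstd0, card_empty, add_zero]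
    calc ∑ T ∈ univ.erase ∅, (if colexStd Y T then T.card else 0)
        ≤ ∑ T ∈ univ.erase ∅, (if colexStd Y T then N else 0) :=
          sum_le_sum fun T _ => by split_ifs <;> [exact (card_le_univ T).trans (by rw [Fintype.card_fin]); exact le_rfl]
      _ = N * ((univ.erase (∅ : Finset (Fin N))).filter fun T => colexStd Y T).card := by rw [← sum_filter, sum_const, smul_eq_mul, mul_comm]
      _ ≤ N * (Y.card - 1) := Nat.mul_le_mul_left _ ?_
    -- the standard non-empty sets number `|Y| − 1`
    have hcount : ((univ.erase (∅ : Finset (Fin N))).filter fun T => colexStd Y T).card + 1 = oshCount Y N := by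
      unfold oshCount
      rw [filter_erase, card_erase_add_one]
      · congr 1
        exact filter_congr fun T _ => ⟨fun h => ⟨h, (card_le_univ T).trans (by rw [Fintype.card_fin])⟩, fun h => h.1⟩
      · exact mem_filter.2 ⟨mem_univ _, hstd0⟩
    rw [oshCount_top] at hcount
    omega

/-- A flat inside a singleton is a point: `dim_{{y}}(y) = 0`, and in general `dim_Y(y) = 0` when `|Y| ≤ 1`. -/
theorem dimAt_eq_zero_of_card_le_one {Y : Finset (V N)} (hY : Y.card ≤ 1) {y : V N} (hy : y ∈ Y) : dimAt Y y = 0 := by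
  obtain ⟨W, hW, hk⟩ := ClusHilbert.exists_direction Y hy
  rw [← hk]
  have hbot : W = ⊥ := by
    refine (Submodule.eq_bot_iff W).2 fun w hw => ?_
    have h1 := hW w hw
    have : y + w = y := card_le_one.1 hY _ h1 _ hy
    simpa using this
  rw [hbot, finrank_bot]

/-- In `𝔽₂^1`, the origin of the full square moves up in lex: `a_lex(0) ≥ 1` for `Y = V`. -/
theorem one_le_lexIncr_univ_zero : 1 ≤ lexIncr (univ : Finset (V 1)) 0 := by
  unfold lexIncr
  refine le_csSup ⟨1, fun k ⟨U, hU, _, _⟩ => by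
    rw [← hU]; exact (Submodule.finrank_le U).trans (by rw [Module.finrank_pi, Fintype.card_fin])⟩ ?_
  refine ⟨⊤, by rw [finrank_top, Module.finrank_pi, Fintype.card_fin], fun u _ => mem_univ _, fun u _ hu0 => ?_⟩
  have hu : u 0 ≠ 0 := by
    intro h
    apply hu0
    funext i
    rw [Subsingleton.elim i 0, h]; rfl
  exact ClusHilbert.lexRank_lt_of_lead_zero (t := 0) (fun i hi => absurd hi (Fin.not_lt_zero i)) hu rfl

/-- **Base: `(OSH-RUNG)` in dimension `1`** (the two-point computation). -/
theorem oshRung_one : OshRung 1 := by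
  classical
  intro Y
  have hS := oshS_le Y
  have hdim : ∑ y ∈ Y, dimAt Y y ≤ Y.card := (sum_le_sum fun y _ => dimAt_le Y y).trans (by simp)
  have hcardV : Fintype.card (V 1) = 2 := by rw [Fintype.card_fun, ZMod.card, Fintype.card_fin]; rfl
  by_cases hYu : Y = univ
  · subst hYu
    rw [if_pos rfl]
    have hcard : (univ : Finset (V 1)).card = 2 := by rw [card_univ, hcardV]
    have ha : 1 ≤ ∑ y ∈ (univ : Finset (V 1)), lexIncr univ y :=
      le_trans one_le_lexIncr_univ_zero (single_le_sum (fun _ _ => Nat.zero_le _) (mem_univ 0))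
    rw [hcard] at hS hdim
    omega
  · rw [if_neg hYu]
    have hlt : Y.card ≤ 1 := by
      have h2 : Y.card < 2 := by
        rw [← hcardV, ← card_univ]
        exact card_lt_card (ssubset_of_ne_of_subset hYu (subset_univ Y))
      omega
    have hdim0 : ∑ y ∈ Y, dimAt Y y = 0 := sum_eq_zero fun y hy => dimAt_eq_zero_of_card_le_one hlt hy
    rw [hdim0]
    have : oshS Y = 0 := by have := hS; omega
    rw [this]
    exact Nat.zero_le _

/-- **Reduction (osh-P2.md §3): `(LAST-STEP)` at all `N' < N` gives `(OSH-RUNG)` at `N`** (p1's statement verbatim; base `N ≤ 1` direct). -/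
theorem oshRung_of_lastStep (N : ℕ) (h : ∀ N' < N, LastStep N') : OshRung N := by
  rcases Nat.eq_zero_or_pos N with h0 | hpos
  · subst h0; exact oshRung_zero
  · exact oshRung_of_lastStep_of_one oshRung_one N hpos fun N' _ hN' => h N' hN'

end Summit.PneNP.PneNP.Theorems.ClusHilbert.Osh
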